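import Literature.NumberTheory.BeurlingPrimes.WellBehavedSystems
import Literature.NumberTheory.BeurlingPrimes.IntegerCounting
import Literature.NumberTheory.BeurlingPrimes.ErrorExponents
import Literature.NumberTheory.BeurlingPrimes.BeurlingPerronFormula
import HarnessLib

/-!
# A Beurling zeta function with `N(x) = ax + O(x^{1/2+ε})`, Lindelöf growth and one zero off the line

Topic `Literature/NumberTheory/BeurlingPrimes`. Everything in this file is PROVED, from the named fact
`Literature.NumberTheory.BeurlingPrimes.BrouckeDebruyneRevesz2023_thm32` (`WellBehavedSystems.lean`;
Broucke–Debruyne–Révész 2023, Theorem 3.2, arXiv:2309.01567 p. 7: Beurling systems whose zeta function has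
prescribed real zeros `ℛ` and poles `𝒮`) in the case `ℛ = {ρ₀}`, `𝒮 = ∅`, `δ = 1/4`:

* `BrouckeDebruyneRevesz2023_thm32.lindelofWitness` — for every `ρ₀ ∈ (0, 1)` there are a Beurling system
  `𝒫`, `a > 0` and a function `ζ̃` on `ℂ` with: `|N_𝒫(x) − ax| ≤ C_ε x^{1/2+ε}` for all `x ≥ 1` and every
  `ε > 0`; `ζ̃ = ζ_𝒫` on `Re s > 1`; `ζ̃` holomorphic on `{Re s > 1/2} ∖ {1}`; **Lindelöf growth**
  `|ζ̃(σ+it)| ≤ C_{σ₀,ε} |t|^ε` for `σ ≥ σ₀ > 1/2`, `|t| ≥ 1`; and `ζ̃(s) = 0 ↔ s = ρ₀` on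
  `{Re s > 1/2} ∖ {1}`. With `3/4 < ρ₀ < 1` this is the calibration asked for by route
  RiemannHypothesis/LindelofBridge (former item BeurlingLindelofWitness, `…lindelofWitness_threeQuarters`):
  in the class of Beurling zeta functions with `N(x) = ax + O_ε(x^{1/2+ε})` the Lindelöf hypothesis holds
  while quasi-RH(`3/4`) fails and there are finitely many (one) but not zero zeros off the critical
  half-plane's edge — so "LH ⟹ quasi-RH" and "finitely many deep zeros ⟹ none" must use `ℤ`-structure.

## Proof (BDR 2023, Theorem 3.2 and the remark after it, p. 7)

Theorem 3.2 gives `ζ_𝒫(s) = E(s) e^{Z(s)}` on `Re s > 1` with `E(s) = s/(s−1) · (s−ρ₀)/s · (s/(s−1/4))^M`,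
`Z` holomorphic on `Re s > 0` and `|Z(σ+it)| ≤ K(σ/(σ−1/2) + σ√(log(|t|+1)/(σ−1/2)))` (`σ > 1/2`). Put
`ζ̃ := E·e^Z`. On `σ₀ ≤ σ ≤ 2`, `|t| ≥ 1`: `|E| ≤ 4·2^M` and `|Z| ≤ A + B√log(|t|+1)`, and
`B√L ≤ εL + B²/(4ε)` gives `e^{|Z|} ≤ e^{A + B²/(4ε)} (|t|+1)^ε ≤ 2^ε e^{A+B²/(4ε)} |t|^ε`. On `σ ≥ 2`:
`|ζ̃| = |ζ_𝒫(σ+it)| ≤ Σ_k n_k^{−σ} ≤ Σ_k n_k^{−2} < ∞`, the series converging because `N_𝒫(x) ≤ (a + C)x`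
(tree: `Hilberdink.summable_prime_rpow`, `summable_genInt_rpow`, `norm_zeta_le_tsum`). The integer bound is
read off with the tree's `sqrt_mul_exp_log_rpow_le` (`x^{1/2} e^{c(log x)^{2/3}} ≪_ε x^{1/2+ε}`) and
`intErrorLE_of_forall_ge` (an eventual bound is a bound on `[1, ∞)`, `N_𝒫` being monotone), `ErrorExponents.lean`.

## References

* [BrouckeDebruyneRevesz2023] F. Broucke, G. Debruyne, Sz. Gy. Révész, *Some examples of well-behaved Beurling
  number systems*, arXiv:2309.01567 = Trans. AMS (2024), Theorem 3.2 (p. 7) and its proof (p. 8).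
-/

noncomputable section

open Complex Filter Set
open scoped Topology

namespace Literature.NumberTheory.BeurlingPrimes

open Literature.Barriers.RiemannHypothesis

/-! ### Elementary growth lemmas -/

/-- `e^{A + B√log(|t|+1)} ≤ 2^ε e^{A + B²/(4ε)} |t|^ε` for `|t| ≥ 1`, `ε > 0`
(`B√L ≤ εL + B²/(4ε)` and `|t| + 1 ≤ 2|t|`). [folklore] -/
theorem exp_add_mul_sqrt_log_le {A B ε t : ℝ} (hε : 0 < ε) (ht : 1 ≤ |t|) :
    Real.exp (A + B * Real.sqrt (Real.log (|t| + 1))) ≤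
      (2 : ℝ) ^ ε * Real.exp (A + B ^ 2 / (4 * ε)) * |t| ^ ε := by
  set L : ℝ := Real.log (|t| + 1) with hL
  have ht0 : 0 < |t| := one_pos.trans_le ht
  have hL0 : 0 ≤ L := Real.log_nonneg (by linarith)
  have hsq : B * Real.sqrt L ≤ ε * L + B ^ 2 / (4 * ε) := by
    have h1 : 0 ≤ (Real.sqrt L * ε - B / 2) ^ 2 := sq_nonneg _
    have h2 : Real.sqrt L ^ 2 = L := Real.sq_sqrt hL0
    have h3 : ε * L + B ^ 2 / (4 * ε) - B * Real.sqrt L = (Real.sqrt L * ε - B / 2) ^ 2 / ε := by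
      field_simp
      nlinarith [h2]
    have h4 : 0 ≤ (Real.sqrt L * ε - B / 2) ^ 2 / ε := by positivity
    linarith
  have hexpL : Real.exp (ε * L) = (|t| + 1) ^ ε := by
    rw [hL, Real.rpow_def_of_pos (by linarith), mul_comm]
  calc Real.exp (A + B * Real.sqrt L)
      ≤ Real.exp (A + (ε * L + B ^ 2 / (4 * ε))) := Real.exp_le_exp.2 (by linarith)
    _ = Real.exp (A + B ^ 2 / (4 * ε)) * (|t| + 1) ^ ε := by
        rw [← hexpL, ← Real.exp_add]; ring_nf
    _ ≤ Real.exp (A + B ^ 2 / (4 * ε)) * (2 * |t|) ^ ε := by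
        gcongr
        linarith
    _ = (2 : ℝ) ^ ε * Real.exp (A + B ^ 2 / (4 * ε)) * |t| ^ ε := by
        rw [Real.mul_rpow (by norm_num) ht0.le]; ring

/-- The explicit factor `E(s) = s/(s−1) · (s−ρ₀)/s · (s/(s−δ))^M` of BDR Thm 3.2 (`ℛ = {ρ₀}`, `𝒮 = ∅`) is
bounded by `4·2^M` at height `|Im s| ≥ 1` (`0 ≤ ρ₀ ≤ 1`, `0 ≤ δ ≤ 1`): each of `|s/(s−1)|`, `|(s−ρ₀)/s|`,
`|s/(s−δ)|` is `≤ 2` since the denominators have modulus `≥ |Im s| ≥ 1`. [folklore] -/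
theorem norm_bdrFactor_le {ρ₀ δ : ℝ} (hρ₀ : 0 ≤ ρ₀) (hρ₀' : ρ₀ ≤ 1) (hδ : 0 ≤ δ) (hδ' : δ ≤ 1) (M : ℕ)
    {s : ℂ} (hs : 1 ≤ |s.im|) :
    ‖s / (s - 1) * ((s - ρ₀) / s) * (s / (s - δ)) ^ M‖ ≤ 4 * 2 ^ M := by
  have him : ∀ r : ℝ, 1 ≤ ‖s - r‖ := fun r ↦ by
    calc (1 : ℝ) ≤ |s.im| := hs
      _ = |(s - r).im| := by simp
      _ ≤ ‖s - r‖ := abs_im_le_norm _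
  have hs0 : 1 ≤ ‖s‖ := by simpa using him 0
  have hsne : s ≠ 0 := fun h ↦ by
    rw [h, norm_zero] at hs0
    exact absurd hs0 (by norm_num)
  -- `|s/(s−r)| ≤ 2` and `|(s−r)/s| ≤ 2` for `0 ≤ r ≤ 1`
  have hquot : ∀ r : ℝ, 0 ≤ r → r ≤ 1 → ‖s / (s - r)‖ ≤ 2 := by
    intro r hr hr1
    have hne : s - r ≠ 0 := fun h ↦ by
      have h1 := him r
      rw [h, norm_zero] at h1
      exact absurd h1 (by norm_num)
    rw [norm_div, div_le_iff₀ (norm_pos_iff.2 hne)]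
    calc ‖s‖ = ‖(s - r) + r‖ := by ring_nf
      _ ≤ ‖s - r‖ + ‖(r : ℂ)‖ := norm_add_le _ _
      _ ≤ ‖s - r‖ + 1 * ‖s - r‖ := by
          gcongr
          rw [Complex.norm_real, Real.norm_eq_abs, abs_of_nonneg hr]
          linarith [him r]
      _ = 2 * ‖s - r‖ := by ring
  have hquot' : ‖(s - ρ₀) / s‖ ≤ 2 := by
    rw [norm_div, div_le_iff₀ (norm_pos_iff.2 hsne)]
    calc ‖s - ρ₀‖ ≤ ‖s‖ + ‖(ρ₀ : ℂ)‖ := norm_sub_le _ _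
      _ ≤ ‖s‖ + 1 * ‖s‖ := by
          gcongr
          rw [Complex.norm_real, Real.norm_eq_abs, abs_of_nonneg hρ₀]
          linarith
      _ = 2 * ‖s‖ := by ring
  have h1 : ‖s / (s - 1)‖ ≤ 2 := by simpa using hquot 1 zero_le_one le_rfl
  have h3 : ‖(s / (s - δ)) ^ M‖ ≤ 2 ^ M := by
    rw [norm_pow]
    exact pow_le_pow_left₀ (norm_nonneg _) (hquot δ hδ hδ') M
  calc ‖s / (s - 1) * ((s - ρ₀) / s) * (s / (s - δ)) ^ M‖
      = ‖s / (s - 1)‖ * ‖(s - ρ₀) / s‖ * ‖(s / (s - δ)) ^ M‖ := by rw [norm_mul, norm_mul]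
    _ ≤ 2 * 2 * 2 ^ M := by gcongr
    _ = 4 * 2 ^ M := by norm_num

/-- **`|ζ_𝒫(σ+it)| ≤ Σ_k n_k^{−2}` for `σ ≥ 2`** when `N_𝒫(x) ≤ Kx` (absolute convergence of the Dirichlet
series over the generalized integers, tree `summable_genInt_rpow`, and `n_k ≥ 1`). [folklore] -/
theorem norm_zeta_le_tsum_two (P : BeurlingPrimes) {K : ℝ} (hK : ∀ x : ℝ, 1 ≤ x → (P.intCount x : ℝ) ≤ K * x)
    {s : ℂ} (hs : 2 ≤ s.re) :
    ‖P.zeta s‖ ≤ ∑' k : ℕ →₀ ℕ, P.genInt k ^ (-(2 : ℝ)) := by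
  have hσ1 : 1 < s.re := by linarith
  have hsum := Hilberdink.summable_prime_rpow P hK hσ1
  have h1 := P.norm_zeta_le_tsum (σ := s.re) (by linarith) hsum s.im
  have hs' : ((s.re : ℂ) + s.im * I) = s := Complex.re_add_im s
  rw [hs'] at h1
  refine h1.trans ?_
  have hS2 : Summable fun k : ℕ →₀ ℕ ↦ P.genInt k ^ (-(2 : ℝ)) := P.summable_genInt_rpow hK one_lt_two
  have hSσ : Summable fun k : ℕ →₀ ℕ ↦ P.genInt k ^ (-s.re) := P.summable_genInt_rpow hK hσ1
  have hterm : ∀ k : ℕ →₀ ℕ, ‖((P.genInt k : ℝ) : ℂ) ^ (-(s.re : ℂ))‖ = P.genInt k ^ (-s.re) := by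
    intro k
    rw [Complex.norm_cpow_eq_rpow_re_of_pos (P.genInt_pos k)]
    simp
  simp_rw [hterm]
  refine Summable.tsum_le_tsum (fun k ↦ ?_) hSσ hS2
  exact Real.rpow_le_rpow_of_exponent_le (P.one_le_genInt k) (by linarith)

/-! ### The witness -/

/-- **A Beurling zeta function with square-root integer error, Lindelöf growth and exactly one zero in
`Re s > 1/2`** (Broucke–Debruyne–Révész 2023, Theorem 3.2 with `ℛ = {ρ₀}`, `𝒮 = ∅`, `δ = 1/4`, and the
remark after it: `ζ_𝒫 = E·e^Z`, "its zeros in this half-plane are precisely the elements of `ℛ`"). For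
every real `ρ₀ ∈ (0,1)` there are a Beurling system `𝒫`, `a > 0` and `ζ̃ : ℂ → ℂ` with
(i) `|N_𝒫(x) − ax| ≤ C_ε x^{1/2+ε}` (`x ≥ 1`, every `ε > 0`: `IntErrorLE a (1/2+ε)`); (ii) `ζ̃ = ζ_𝒫` on `Re s > 1`;
(iii) `ζ̃` holomorphic on `{Re s > 1/2} ∖ {1}`; (iv) `|ζ̃(s)| ≤ C_{σ₀,ε} |Im s|^ε` for `Re s ≥ σ₀ > 1/2`,
`|Im s| ≥ 1`; (v) for `Re s > 1/2`, `s ≠ 1`: `ζ̃(s) = 0 ↔ s = ρ₀`. Here `ζ̃ = E·e^Z` with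
`E(s) = s/(s−1) · (s−ρ₀)/s · (s/(s−1/4))^M`. [cite: BrouckeDebruyneRevesz2023, Theorem 3.2 (arXiv:2309.01567 p. 7), case ℛ = {ρ₀}, 𝒮 = ∅] -/
theorem BrouckeDebruyneRevesz2023_thm32.lindelofWitness (h : BrouckeDebruyneRevesz2023_thm32)
    {ρ₀ : ℝ} (hρ₀ : 0 < ρ₀) (hρ₀' : ρ₀ < 1) :
    ∃ (P : BeurlingPrimes) (a : ℝ) (Z : ℂ → ℂ), 0 < a ∧
      (∀ ε : ℝ, 0 < ε → P.IntErrorLE a (1 / 2 + ε)) ∧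
      (∀ s : ℂ, 1 < s.re → Z s = P.zeta s) ∧
      DifferentiableOn ℂ Z {s : ℂ | 1 / 2 < s.re ∧ s ≠ 1} ∧
      (∀ σ₀ : ℝ, 1 / 2 < σ₀ → ∀ ε : ℝ, 0 < ε → ∃ C : ℝ, ∀ s : ℂ, σ₀ ≤ s.re → 1 ≤ |s.im| →
        ‖Z s‖ ≤ C * |s.im| ^ ε) ∧
      (∀ s : ℂ, 1 / 2 < s.re → s ≠ 1 → (Z s = 0 ↔ s = ρ₀)) := by
  classical
  obtain ⟨P, -, ⟨a, c, C₂, b, ha, hc, -, hN⟩, ⟨M, Zb, K, hZd, hZb, hzeta⟩⟩ :=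
    h {ρ₀} ∅ (1 / 4) (Finset.disjoint_empty_right _) (by simpa using And.intro hρ₀ hρ₀') (by simp)
      (by norm_num) (by norm_num)
  -- the continuation `ζ̃ = E e^Z`
  set E : ℂ → ℂ := fun s ↦ s / (s - 1) * ((s - ρ₀) / s) * (s / (s - (1 / 4 : ℝ))) ^ M with hE
  set Zt : ℂ → ℂ := fun s ↦ E s * Complex.exp (Zb s) with hZt
  -- (i) the integer bound: `x^{1/2} e^{c (log x)^{2/3}} ≤ D_ε x^{1/2+ε}` and eventual ⇒ global
  have hN2 : ∀ x : ℝ, 2 ≤ x →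
      |(P.intCount x : ℝ) - a * x| ≤ C₂ * (x ^ (1 / 2 : ℝ) * Real.exp (c * Real.log x ^ (2 / 3 : ℝ))) := by
    intro x hx
    simpa using hN x hx
  have hC₂ : 0 ≤ C₂ := by
    have h0 := (abs_nonneg _).trans (hN2 2 le_rfl)
    exact nonneg_of_mul_nonneg_left h0 (by positivity)
  have hint : ∀ ε : ℝ, 0 < ε → P.IntErrorLE a (1 / 2 + ε) := by
    intro ε hε
    obtain ⟨D, -, hD⟩ := sqrt_mul_exp_log_rpow_le hc hε
    refine P.intErrorLE_of_forall_ge (X := 2) (C := C₂ * D) (by linarith) fun x hx ↦ ?_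
    calc |(P.intCount x : ℝ) - a * x|
        ≤ C₂ * (x ^ (1 / 2 : ℝ) * Real.exp (c * Real.log x ^ (2 / 3 : ℝ))) := hN2 x hx
      _ ≤ C₂ * (D * x ^ (1 / 2 + ε)) := mul_le_mul_of_nonneg_left (hD x (by linarith)) hC₂
      _ = C₂ * D * x ^ (1 / 2 + ε) := by ring
  -- `N_𝒫(x) ≤ (a + C) x` on `x ≥ 1`, hence the Dirichlet series converges absolutely for `σ > 1`
  obtain ⟨C₁, hC₁⟩ := hint (1 / 2) one_half_pos
  have hKx : ∀ x : ℝ, 1 ≤ x → (P.intCount x : ℝ) ≤ (a + C₁) * x := by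
    intro x hx
    have h1 := (abs_sub_le_iff.1 (hC₁ x hx)).1
    have h2 : x ^ (1 / 2 + 1 / 2 : ℝ) = x := by norm_num
    rw [h2] at h1
    linarith
  -- (ii) `ζ̃ = ζ_𝒫` on `Re s > 1`
  have hZζ : ∀ s : ℂ, 1 < s.re → Zt s = P.zeta s := by
    intro s hs
    rw [hzeta s hs]
    simp [hZt, hE]
  -- (iii) holomorphy on `{Re s > 1/2} ∖ {1}`
  have hU : ∀ s ∈ {s : ℂ | 1 / 2 < s.re ∧ s ≠ 1}, s ≠ 0 ∧ s - 1 ≠ 0 ∧ s - (1 / 4 : ℝ) ≠ 0 := by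
    rintro s ⟨hs, hs1⟩
    refine ⟨fun h0 ↦ ?_, sub_ne_zero.2 hs1, fun h4 ↦ ?_⟩
    · rw [h0] at hs; norm_num at hs
    · have := congrArg Complex.re (sub_eq_zero.1 h4)
      simp at this; linarith
  have hEd : DifferentiableOn ℂ E {s : ℂ | 1 / 2 < s.re ∧ s ≠ 1} := by
    intro s hs
    obtain ⟨h0, h1, h4⟩ := hU s hs
    have hid : DifferentiableAt ℂ (fun s : ℂ ↦ s) s := differentiableAt_id
    refine DifferentiableAt.differentiableWithinAt ?_
    exact ((hid.div (hid.sub_const 1) h1).mul ((hid.sub_const _).div hid h0)).mul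
      ((hid.div (hid.sub_const _) h4).pow M)
  have hZtd : DifferentiableOn ℂ Zt {s : ℂ | 1 / 2 < s.re ∧ s ≠ 1} :=
    hEd.mul ((hZd.mono fun s hs ↦ by exact lt_trans one_half_pos hs.1).cexp)
  -- (v) zeros
  have hzero : ∀ s : ℂ, 1 / 2 < s.re → s ≠ 1 → (Zt s = 0 ↔ s = ρ₀) := by
    intro s hs hs1
    obtain ⟨h0, h1, h4⟩ := hU s ⟨hs, hs1⟩
    have hA : s / (s - 1) ≠ 0 := div_ne_zero h0 h1
    have hC : (s / (s - (1 / 4 : ℝ))) ^ M ≠ 0 := pow_ne_zero _ (div_ne_zero h0 h4)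
    have hB : (s - ρ₀) / s = 0 ↔ s = ρ₀ := by
      rw [div_eq_zero_iff, sub_eq_zero, or_iff_left h0]
    have hE0 : E s = 0 ↔ s = ρ₀ := by
      show s / (s - 1) * ((s - ρ₀) / s) * (s / (s - (1 / 4 : ℝ))) ^ M = 0 ↔ s = ρ₀
      rw [mul_eq_zero, mul_eq_zero, or_iff_left hC, or_iff_right hA, hB]
    show E s * Complex.exp (Zb s) = 0 ↔ s = ρ₀
    rw [mul_eq_zero, or_iff_left (Complex.exp_ne_zero _), hE0]
  -- (iv) Lindelöf growth
  have hgrowth : ∀ σ₀ : ℝ, 1 / 2 < σ₀ → ∀ ε : ℝ, 0 < ε → ∃ C : ℝ, ∀ s : ℂ, σ₀ ≤ s.re → 1 ≤ |s.im| →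
      ‖Zt s‖ ≤ C * |s.im| ^ ε := by
    intro σ₀ hσ₀ ε hε
    -- constants on the strip `σ₀ ≤ σ ≤ 2`
    set K' : ℝ := max K 0 with hK'
    have hK'0 : 0 ≤ K' := le_max_right _ _
    set A : ℝ := K' * (2 / (σ₀ - 1 / 2)) with hA
    set B : ℝ := K' * (2 / Real.sqrt (σ₀ - 1 / 2)) with hB
    set S₂ : ℝ := ∑' k : ℕ →₀ ℕ, P.genInt k ^ (-(2 : ℝ)) with hS₂
    have hS₂0 : 0 ≤ S₂ := tsum_nonneg fun k ↦ Real.rpow_nonneg (P.genInt_pos k).le _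
    refine ⟨max (4 * 2 ^ M * ((2 : ℝ) ^ ε * Real.exp (A + B ^ 2 / (4 * ε)))) S₂, fun s hσ ht ↦ ?_⟩
    have ht0 : 0 < |s.im| := one_pos.trans_le ht
    have htpow : 1 ≤ |s.im| ^ ε := Real.one_le_rpow ht hε.le
    rcases le_or_gt s.re 2 with hs2 | hs2
    · -- the strip: `|E| ≤ 4·2^M`, `|Z| ≤ A + B √log(|t|+1)`
      have hσpos : 0 < s.re - 1 / 2 := by linarith
      have hre0 : 0 < s.re := by linarith
      have hZb' : ‖Zb s‖ ≤ A + B * Real.sqrt (Real.log (|s.im| + 1)) := by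
        have h1 := hZb s (by linarith)
        set L : ℝ := Real.log (|s.im| + 1) with hL
        have hL0 : 0 ≤ L := Real.log_nonneg (by linarith [abs_nonneg s.im])
        have hX0 : 0 ≤ s.re / (s.re - 1 / 2) + s.re * Real.sqrt (L / (s.re - 1 / 2)) :=
          add_nonneg (div_nonneg hre0.le hσpos.le) (mul_nonneg hre0.le (Real.sqrt_nonneg _))
        have h2 : ‖Zb s‖ ≤ K' * (s.re / (s.re - 1 / 2) + s.re * Real.sqrt (L / (s.re - 1 / 2))) :=
          h1.trans (mul_le_mul_of_nonneg_right (le_max_left _ _) hX0)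
        -- `σ/(σ−1/2) ≤ 2/(σ₀−1/2)` and `σ √(L/(σ−1/2)) ≤ 2 √L/√(σ₀−1/2)`
        have h3 : s.re / (s.re - 1 / 2) ≤ 2 / (σ₀ - 1 / 2) := by
          rw [div_le_div_iff₀ hσpos (by linarith)]
          nlinarith [mul_nonneg (sub_nonneg.2 hs2) hσpos.le, mul_nonneg hre0.le (sub_nonneg.2 hσ)]
        have h4 : s.re * Real.sqrt (L / (s.re - 1 / 2)) ≤ 2 / Real.sqrt (σ₀ - 1 / 2) * Real.sqrt L := by
          rw [Real.sqrt_div hL0]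
          have hsq0 : 0 < Real.sqrt (σ₀ - 1 / 2) := Real.sqrt_pos.2 (by linarith)
          have hsq : Real.sqrt (σ₀ - 1 / 2) ≤ Real.sqrt (s.re - 1 / 2) := Real.sqrt_le_sqrt (by linarith)
          have h5 : Real.sqrt L / Real.sqrt (s.re - 1 / 2) ≤ Real.sqrt L / Real.sqrt (σ₀ - 1 / 2) :=
            div_le_div_of_nonneg_left (Real.sqrt_nonneg L) hsq0 hsq
          calc s.re * (Real.sqrt L / Real.sqrt (s.re - 1 / 2))
              ≤ 2 * (Real.sqrt L / Real.sqrt (σ₀ - 1 / 2)) := mul_le_mul hs2 h5 (by positivity) (by norm_num)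
            _ = 2 / Real.sqrt (σ₀ - 1 / 2) * Real.sqrt L := by ring
        calc ‖Zb s‖ ≤ K' * (s.re / (s.re - 1 / 2) + s.re * Real.sqrt (L / (s.re - 1 / 2))) := h2
          _ ≤ K' * (2 / (σ₀ - 1 / 2) + 2 / Real.sqrt (σ₀ - 1 / 2) * Real.sqrt L) := by gcongr
          _ = A + B * Real.sqrt L := by rw [hA, hB]; ring
      have hexp : ‖Complex.exp (Zb s)‖ ≤ (2 : ℝ) ^ ε * Real.exp (A + B ^ 2 / (4 * ε)) * |s.im| ^ ε :=
        calc ‖Complex.exp (Zb s)‖ ≤ Real.exp ‖Zb s‖ := Complex.norm_exp_le_exp_norm _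
          _ ≤ Real.exp (A + B * Real.sqrt (Real.log (|s.im| + 1))) := Real.exp_le_exp.2 hZb'
          _ ≤ _ := exp_add_mul_sqrt_log_le hε ht
      have hEs : ‖E s‖ ≤ 4 * 2 ^ M :=
        norm_bdrFactor_le hρ₀.le hρ₀'.le (by norm_num) (by norm_num) M ht
      calc ‖Zt s‖ = ‖E s‖ * ‖Complex.exp (Zb s)‖ := norm_mul _ _
        _ ≤ 4 * 2 ^ M * ((2 : ℝ) ^ ε * Real.exp (A + B ^ 2 / (4 * ε)) * |s.im| ^ ε) := by gcongr
        _ = 4 * 2 ^ M * ((2 : ℝ) ^ ε * Real.exp (A + B ^ 2 / (4 * ε))) * |s.im| ^ ε := by ring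
        _ ≤ max (4 * 2 ^ M * ((2 : ℝ) ^ ε * Real.exp (A + B ^ 2 / (4 * ε)))) S₂ * |s.im| ^ ε := by
            gcongr
            exact le_max_left _ _
    · -- `σ > 2`: the Dirichlet series
      have hs1 : 1 < s.re := by linarith
      calc ‖Zt s‖ = ‖P.zeta s‖ := by rw [hZζ s hs1]
        _ ≤ S₂ := norm_zeta_le_tsum_two P hKx hs2.le
        _ ≤ max (4 * 2 ^ M * ((2 : ℝ) ^ ε * Real.exp (A + B ^ 2 / (4 * ε)))) S₂ := le_max_right _ _
        _ ≤ max (4 * 2 ^ M * ((2 : ℝ) ^ ε * Real.exp (A + B ^ 2 / (4 * ε)))) S₂ * |s.im| ^ ε :=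
            le_mul_of_one_le_right (hS₂0.trans (le_max_right _ _)) htpow
  exact ⟨P, a, Zt, ha, hint, hZζ, hZtd, hgrowth, hzero⟩

/-- **The calibration for route RiemannHypothesis/LindelofBridge** (shape of the former route item
BeurlingLindelofWitness): a Beurling system with `N(x) = ax + O_ε(x^{1/2+ε})` whose zeta function continues
holomorphically to `{Re s > 1/2} ∖ {1}` with Lindelöf growth `≪ |t|^ε` on `Re s ≥ σ₀ > 1/2`, `|t| ≥ 1`, and
vanishes there exactly at `s = ρ₀` (`= ρ̄₀`), `3/4 < Re ρ₀ < 1` — so neither "LH ⟹ quasi-RH(3/4)" nor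
"finitely many zeros in `Re s > 1/2` ⟹ none" holds in the Beurling class. (`lindelofWitness` with
`ρ₀ = 7/8`.) [cite: BrouckeDebruyneRevesz2023, Theorem 3.2 (arXiv:2309.01567 p. 7), case ℛ = {7/8}, 𝒮 = ∅] -/
theorem BrouckeDebruyneRevesz2023_thm32.lindelofWitness_threeQuarters (h : BrouckeDebruyneRevesz2023_thm32) :
    ∃ (P : BeurlingPrimes) (a : ℝ) (Z : ℂ → ℂ) (ρ₀ : ℂ), 0 < a ∧ 3 / 4 < ρ₀.re ∧ ρ₀.re < 1 ∧
      (∀ ε : ℝ, 0 < ε → ∃ C : ℝ, ∀ x : ℝ, 1 ≤ x → |(P.intCount x : ℝ) - a * x| ≤ C * x ^ (1 / 2 + ε)) ∧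
      (∀ s : ℂ, 1 < s.re → Z s = P.zeta s) ∧
      DifferentiableOn ℂ Z {s : ℂ | 1 / 2 < s.re ∧ s ≠ 1} ∧
      (∀ σ₀ : ℝ, 1 / 2 < σ₀ → ∀ ε : ℝ, 0 < ε → ∃ C : ℝ, ∀ s : ℂ, σ₀ ≤ s.re → 1 ≤ |s.im| →
        ‖Z s‖ ≤ C * |s.im| ^ ε) ∧
      (∀ s : ℂ, 1 / 2 < s.re → s ≠ 1 → (Z s = 0 ↔ s = ρ₀ ∨ s = starRingEnd ℂ ρ₀)) := by
  obtain ⟨P, a, Z, ha, hN, hZ, hd, hg, hz⟩ :=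
    h.lindelofWitness (ρ₀ := 7 / 8) (by norm_num) (by norm_num)
  refine ⟨P, a, Z, ((7 / 8 : ℝ) : ℂ), ha, by norm_num, by norm_num, fun ε hε ↦ hN ε hε, hZ, hd, hg,
    fun s hs hs1 ↦ ?_⟩
  rw [hz s hs hs1, Complex.conj_ofReal, or_self]

end Literature.NumberTheory.BeurlingPrimes

end
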